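import Mathlib.NumberTheory.Padics.HeightOneSpectrum
import Mathlib.NumberTheory.NumberField.Basic
import Mathlib.Data.ZMod.QuotientRing
import HarnessLib

/-!
# The place `2` of `ℚ`: generator, residue field, and `2 ∉ v²`

`Proofs` file (theorems only, no definitions, no named facts) in topic
`NumberTheory/GaloisRepresentations`, landed by the seat of bsd.S15
(`Literature.NumberTheory.EllipticCurves.conductorNorm_eq_artinConductorNat_of_isElliptic`): the
three facts about a finite place `v` of `ℚ` with `2 ∈ v` that the explicit-field certificates at
`2` consume (`DegreeFromRamificationProofs`: `#(𝓞 ℚ / v) = 2`; `RamificationCertificatesProofs`: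
`v(2) = 1`, i.e. `2 ∉ v²`), from Mathlib's `Rat.HeightOneSpectrum.natGenerator`.

* `Rat.natGenerator_eq_of_prime_mem` — `p ∈ v` for a prime `p` forces `natGenerator v = p`;
* `Rat.card_quotient_asIdeal_eq_of_prime_mem` — `#(𝓞 ℚ / v) = p`;
* `Rat.prime_notMem_asIdeal_sq` — `p ∉ v²`.

## References

* J.-P. Serre, *Local Fields*, GTM 67 (1979), Ch. I §3 (Dedekind domains: `ℤ`). [folklore]

## Design

Theorems only; `namespace Literature.NumberTheory.GaloisRepresentations`.  Axioms: `propext`,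
`Classical.choice`, `Quot.sound`.
-/

noncomputable section

open scoped NumberField
open IsDedekindDomain Rat.HeightOneSpectrum

namespace Literature.NumberTheory.GaloisRepresentations

variable (v : HeightOneSpectrum (𝓞 ℚ))

/-- `p ∈ v` for a rational prime `p` forces `natGenerator v = p` (`p_v ∣ p`, both prime). [folklore] -/
theorem Rat.natGenerator_eq_of_prime_mem {p : ℕ} (hp : p.Prime) (hpv : (p : 𝓞 ℚ) ∈ v.asIdeal) :
    natGenerator v = p := by
  have hdvd : natGenerator v ∣ p := by
    rw [natGenerator_dvd_iff, ← map_natCast (Rat.IsIntegralClosure.intEquiv (𝓞 ℚ)) p]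
    exact Ideal.mem_map_of_mem _ hpv
  rcases (Nat.dvd_prime hp).mp hdvd with h | h
  · exact absurd h (prime_natGenerator v).one_lt.ne'
  · exact h

/-- `v = (p)` as an ideal of `𝓞 ℚ` when the prime `p` lies in `v`. [folklore] -/
theorem Rat.asIdeal_eq_span_of_prime_mem {p : ℕ} (hp : p.Prime) (hpv : (p : 𝓞 ℚ) ∈ v.asIdeal) :
    v.asIdeal = Ideal.span {(p : 𝓞 ℚ)} := by
  have hgen := Rat.natGenerator_eq_of_prime_mem v hp hpv
  apply le_antisymm
  · intro x hx
    have : Rat.IsIntegralClosure.intEquiv (𝓞 ℚ) x ∈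
        v.asIdeal.map (Rat.IsIntegralClosure.intEquiv (𝓞 ℚ)) := Ideal.mem_map_of_mem _ hx
    rw [← span_natGenerator, Ideal.mem_span_singleton, hgen] at this
    obtain ⟨c, hc⟩ := this
    rw [Ideal.mem_span_singleton]
    refine ⟨(Rat.IsIntegralClosure.intEquiv (𝓞 ℚ)).symm c, ?_⟩
    apply (Rat.IsIntegralClosure.intEquiv (𝓞 ℚ)).injective
    rw [map_mul, map_natCast, RingEquiv.apply_symm_apply, hc]
  · rw [Ideal.span_le, Set.singleton_subset_iff]
    exact hpv

/-- **`#(𝓞 ℚ / v) = p`** when the prime `p` lies in `v`. [folklore] -/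
theorem Rat.card_quotient_asIdeal_eq_of_prime_mem {p : ℕ} (hp : p.Prime)
    (hpv : (p : 𝓞 ℚ) ∈ v.asIdeal) : Nat.card (𝓞 ℚ ⧸ v.asIdeal) = p := by
  have hgen := Rat.natGenerator_eq_of_prime_mem v hp hpv
  have h : Ideal.span {(natGenerator v : ℤ)} =
      v.asIdeal.map (Rat.IsIntegralClosure.intEquiv (𝓞 ℚ) : 𝓞 ℚ →+* ℤ) := span_natGenerator v
  rw [← hgen]
  exact (Nat.card_congr ((Ideal.quotientEquiv _ _ (Rat.IsIntegralClosure.intEquiv (𝓞 ℚ)) h).trans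
    (Int.quotientSpanNatEquivZMod _)).toEquiv).trans (Nat.card_zmod _)

/-- **`p ∉ v²`** (`v(p) = 1`) when the prime `p` lies in `v`: `v² = (p²)` and `p² ∤ p` in `ℤ`.
[folklore] -/
theorem Rat.prime_notMem_asIdeal_sq {p : ℕ} (hp : p.Prime) (hpv : (p : 𝓞 ℚ) ∈ v.asIdeal) :
    (p : 𝓞 ℚ) ∉ v.asIdeal ^ 2 := by
  rw [Rat.asIdeal_eq_span_of_prime_mem v hp hpv, Ideal.span_singleton_pow, Ideal.mem_span_singleton]
  rintro ⟨c, hc⟩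
  have h := congrArg (Rat.IsIntegralClosure.intEquiv (𝓞 ℚ)) hc
  rw [map_mul, map_pow, map_natCast] at h
  -- `p = p² c` in `ℤ` forces `p c = 1`, impossible for a prime `p`
  have hp0 : (p : ℤ) ≠ 0 := by exact_mod_cast hp.ne_zero
  have h1 : (p : ℤ) * (p * Rat.IsIntegralClosure.intEquiv (𝓞 ℚ) c) = p * 1 := by
    rw [mul_one]; linear_combination -h
  have h2 := mul_left_cancel₀ hp0 h1
  have hu : IsUnit (p : ℤ) := IsUnit.of_mul_eq_one _ h2
  rw [Int.isUnit_iff_natAbs_eq, Int.natAbs_natCast] at hu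
  exact hp.one_lt.ne' hu

end Literature.NumberTheory.GaloisRepresentations

end
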